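import Summits.HodgeConjecture.HodgeConjecture.Theses.SevenfoldWeilCensus
import Literature.AlgebraicGeometry.HodgeTheory.AlgebraicClassesCupAbelianVariety
import HarnessLib

/-!
# Assembly of route `SevenfoldWeilCensus` (stmt-HodgeConjecture-18724): the sevenfold reduction

The assembly item of route `SevenfoldWeilCensus`: granted the two census cruxes
`CodimTwoFromLowerDim` (X2: rational `(2,2)`-classes on complex abelian `6`- and `7`-folds are
divisor monomials plus pull-backs of rational `(2,2)`-classes of lower-dimensional abelian varieties)
and `CodimThreeWeilGeneration` (X1: rational `(3,3)`-classes on abelian `6`- and `7`-folds are divisor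
monomials, products `(2,2) · (1,1)`, pull-backs of rational `(3,3)`-classes of lower-dimensional
abelian varieties, and pull-backs of Weil classes of abelian sixfolds), the shared crux
`WeilSixfolds` (Weil classes on abelian sixfolds are algebraic) and the support
`HodgeAbelianDimLeFive` (Markman 2025 Cor. 1.3: the cycle part of the Hodge conjecture on complex
abelian varieties of dimension `≤ 5`), the Hodge conjecture holds for every complex abelian variety
of dimension `≤ 7`.

## The argument (all carriers in the tree)

Strong induction on `dim A ≤ 7`; dimension `≤ 5` is the support. For `dim A = n ∈ {6, 7}` and a
rational `(p,p)`-class `c`: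
* `2p > n`: hard Lefschetz (`nonempty_hardLefschetzNFold_holds`, DISCHARGED in the tree) reduces to
  codimension `n - p < p` (`mem_algebraicClasses_of_lt_of_nonempty`), so `p ≤ 3` suffices;
* `p = 0`: `N⁰ H⁰ = H⁰` (`hodgeConjectureFor_codim_zero`); `p = 1`: Lefschetz `(1,1)`
  (`lefschetzOneOne_rational_holds`, DISCHARGED in the tree);
* `p = 2`: X2; divisor monomials are algebraic on an abelian variety
  (`AbelianVariety.divisorClassesSpan_le_algebraicClasses`, Kleiman moving by translations), and a
  pull-back `g^* w` of a rational `(2,2)`-class of an abelian `C` with `dim C < dim A` is algebraic by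
  induction and `map_mem_algebraicClasses_of_abelianVariety` (pull-back to an abelian variety
  preserves `Nᵖ`, PROVED in the tree);
* `p = 3`: X1; in addition `(2,2) · (1,1)` is algebraic by the case `p = 2`, Lefschetz `(1,1)` and
  `AbelianVariety.cupProduct_mem_algebraicClasses_one`; a Weil class `w ∈ weilClassesOf B ψ 3 d` of an
  abelian sixfold splits as `w = w₊ + w₋` along `E₊ ⊔ E₋` (definition of `weilClassesOf`), which is
  the eigen-decomposition `WeilSixfolds` asks for, so `w` is algebraic on `B` and its pull-back is
  algebraic on `A`.
Hodge models exist (`nonempty_hodgeModel_holds`), which gives `HodgeConjectureFor A.dim A.X`.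

Sorry-free, definition-free; no named fact is consumed beyond the four items.
-/

set_option linter.dupNamespace false

noncomputable section

namespace Summit.HodgeConjecture.HodgeConjecture.Theorems

open CategoryTheory AlgebraicGeometry
open Literature.AlgebraicGeometry.Motives Literature.AlgebraicGeometry.HodgeTheory
  Literature.AlgebraicTopology.SingularHomology Literature.Barriers.HodgeConjecture
open Summit.HodgeConjecture.HodgeConjecture.Theses.SevenfoldWeilCensus

/-- **A Weil class of an abelian sixfold is algebraic, granted `WeilSixfolds`.** A class
`w ∈ weilClassesOf B ψ 3 d = E₊ ⊔ E₋` splits as `w = w₊ + w₋` with `w_±` in the two eigenspaces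
(`Submodule.mem_sup`; membership in `E_±` is by definition the eigen-identity `WeilSixfolds`
quantifies over), so `WeilSixfolds d B ψ` applies. -/
theorem sevenfoldWeilCensus_weilClass_mem_algebraicClasses
    (h₄ : Summit.HodgeConjecture.HodgeConjecture.Theses.SevenfoldWeilCensus.WeilSixfolds)
    {B : AbelianVariety ℂ} (hB : B.dim = 6) {d : ℕ} (hd : 0 < d) {ψ : B ⟶ B}
    (hψ : ψ ≫ ψ = -(d • 𝟙 B)) {w : complexBetti B.X (2 * 3)} (hw : IsRationalClass w)
    (hwt : IsOfHodgeType B.dim B.X (2 * 3) 3 3 w) (hweil : w ∈ weilClassesOf B ψ 3 d) :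
    w ∈ algebraicClasses B.X 3 := by
  have hsp : IsSmoothProjective B.dim B.X := AbelianVariety.isSmoothProjective_holds
  rw [hB] at hsp hwt
  obtain ⟨w₁, hw₁, w₂, hw₂, hw12⟩ := Submodule.mem_sup.mp hweil
  exact h₄ d hd B ψ hB hsp hψ w hw hwt ⟨w₁, w₂, hw12.symm, hw₁, hw₂⟩

/-- **The cycle part of the Hodge conjecture for complex abelian varieties of dimension `≤ 7`,
granted the four items** (strong induction on the dimension; see the module docstring for the
case analysis: hard Lefschetz above the middle, `N⁰ H⁰ = H⁰`, Lefschetz `(1,1)`, X2 in codimension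
`2`, X1 + `WeilSixfolds` in codimension `3`). -/
theorem sevenfoldWeilCensus_mem_algebraicClasses_of_dim_le_seven
    (h₃ : Summit.HodgeConjecture.HodgeConjecture.Theses.SevenfoldWeilCensus.CodimTwoFromLowerDim)
    (h₂ : Summit.HodgeConjecture.HodgeConjecture.Theses.SevenfoldWeilCensus.CodimThreeWeilGeneration)
    (h₄ : Summit.HodgeConjecture.HodgeConjecture.Theses.SevenfoldWeilCensus.WeilSixfolds)
    (h₅ : Summit.HodgeConjecture.HodgeConjecture.Theses.SevenfoldWeilCensus.HodgeAbelianDimLeFive) :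
    ∀ (n : ℕ) (A : AbelianVariety ℂ), A.dim = n → n ≤ 7 →
      ∀ (p : ℕ) (c : complexBetti A.X (2 * p)), IsRationalClass c →
        IsOfHodgeType A.dim A.X (2 * p) p p c → c ∈ algebraicClasses A.X p := by
  intro n
  induction n using Nat.strong_induction_on with
  | _ n ih =>
  intro A hAn hn7
  have hX : IsSmoothProjective A.dim A.X := AbelianVariety.isSmoothProjective_holds
  by_cases h5 : A.dim ≤ 5
  · exact h₅ A h5 hX
  have h67 : A.dim = 6 ∨ A.dim = 7 := by omega
  -- Lefschetz `(1,1)` on `A`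
  have h11 : ∀ b : complexBetti A.X (2 * 1), IsRationalClass b →
      IsOfHodgeType A.dim A.X (2 * 1) 1 1 b → b ∈ algebraicClasses A.X 1 :=
    fun b hb hbt ↦ lefschetzOneOne_rational_holds hX b hb hbt
  -- pull-backs of rational `(q,q)`-classes of lower-dimensional abelian varieties are algebraic
  have hpull : ∀ (q : ℕ) (C : AbelianVariety ℂ) (g : A.X ⟶ C.X) (w : complexBetti C.X (2 * q)),
      C.dim < A.dim → IsRationalClass w → IsOfHodgeType C.dim C.X (2 * q) q q w →
        complexBetti.map g (2 * q) w ∈ algebraicClasses A.X q := by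
    intro q C g w hC hw hwt
    have hwC : w ∈ algebraicClasses C.X q :=
      ih C.dim (by omega) C rfl (by omega) q w hw hwt
    exact map_mem_algebraicClasses_of_abelianVariety hX C g hwC
  -- codimension `2`: X2
  have hp2 : ∀ c : complexBetti A.X (2 * 2), IsRationalClass c →
      IsOfHodgeType A.dim A.X (2 * 2) 2 2 c → c ∈ algebraicClasses A.X 2 := by
    intro c hc hct
    have hle : divisorClassesSpan A.X A.dim 2 ⊔ Submodule.span ℂ {w' : complexBetti A.X (2 * 2) |
        ∃ (C : AbelianVariety ℂ) (g : A.X ⟶ C.X) (w : complexBetti C.X (2 * 2)), C.dim < A.dim ∧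
          IsRationalClass w ∧ IsOfHodgeType C.dim C.X (2 * 2) 2 2 w ∧
          w' = complexBetti.map g (2 * 2) w} ≤ algebraicClasses A.X 2 := by
      refine sup_le (AbelianVariety.divisorClassesSpan_le_algebraicClasses A h11 2)
        (Submodule.span_le.mpr ?_)
      rintro _ ⟨C, g, w, hC, hw, hwt, rfl⟩
      exact hpull 2 C g w hC hw hwt
    exact hle (h₃ A h67 c hc hct)
  -- codimension `3`: X1
  have hp3 : ∀ c : complexBetti A.X (2 * 3), IsRationalClass c →
      IsOfHodgeType A.dim A.X (2 * 3) 3 3 c → c ∈ algebraicClasses A.X 3 := by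
    intro c hc hct
    -- the three non-divisorial generating sets are algebraic
    have hcup : Submodule.span ℂ {w' : complexBetti A.X (2 * 3) |
        ∃ (a : complexBetti A.X (2 * 2)) (b : complexBetti A.X (2 * 1)),
          IsRationalClass a ∧ IsOfHodgeType A.dim A.X (2 * 2) 2 2 a ∧ IsRationalClass b ∧
          IsOfHodgeType A.dim A.X (2 * 1) 1 1 b ∧
          w' = cupProduct (two_mul_add_two_mul 2 1) a b} ≤ algebraicClasses A.X 3 := by
      refine Submodule.span_le.mpr ?_
      rintro _ ⟨a, b, ha, hat, hb, hbt, rfl⟩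
      exact AbelianVariety.cupProduct_mem_algebraicClasses_one A (hp2 a ha hat) (h11 b hb hbt)
    have hlow3 : Submodule.span ℂ {w' : complexBetti A.X (2 * 3) |
        ∃ (C : AbelianVariety ℂ) (g : A.X ⟶ C.X) (w : complexBetti C.X (2 * 3)), C.dim < A.dim ∧
          IsRationalClass w ∧ IsOfHodgeType C.dim C.X (2 * 3) 3 3 w ∧
          w' = complexBetti.map g (2 * 3) w} ≤ algebraicClasses A.X 3 := by
      refine Submodule.span_le.mpr ?_
      rintro _ ⟨C, g, w, hC, hw, hwt, rfl⟩
      exact hpull 3 C g w hC hw hwt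
    have hweil3 : Submodule.span ℂ {w' : complexBetti A.X (2 * 3) |
        ∃ (B : AbelianVariety ℂ) (g : A.X ⟶ B.X) (d : ℕ) (ψ : B ⟶ B) (w : complexBetti B.X (2 * 3)),
          B.dim = 6 ∧ 0 < d ∧ ψ ≫ ψ = -(d • 𝟙 B) ∧ IsRationalClass w ∧
          IsOfHodgeType B.dim B.X (2 * 3) 3 3 w ∧ w ∈ weilClassesOf B ψ 3 d ∧
          w' = complexBetti.map g (2 * 3) w} ≤ algebraicClasses A.X 3 := by
      refine Submodule.span_le.mpr ?_
      rintro _ ⟨B, g, d, ψ, w, hB, hd, hψ, hw, hwt, hweil, rfl⟩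
      exact map_mem_algebraicClasses_of_abelianVariety hX B g
        (sevenfoldWeilCensus_weilClass_mem_algebraicClasses h₄ hB hd hψ hw hwt hweil)
    exact (sup_le (sup_le (sup_le (AbelianVariety.divisorClassesSpan_le_algebraicClasses A h11 3)
      hcup) hlow3) hweil3) (h₂ A h67 c hc hct)
  -- at and below the middle: `p ≤ 3`
  have hlow : ∀ p : ℕ, 2 * p ≤ A.dim → ∀ c : complexBetti A.X (2 * p), IsRationalClass c →
      IsOfHodgeType A.dim A.X (2 * p) p p c → c ∈ algebraicClasses A.X p := by
    intro p hp c hc hct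
    have hp3' : p ≤ 3 := by omega
    interval_cases p
    · exact hodgeConjectureFor_codim_zero c
    · exact h11 c hc hct
    · exact hp2 c hc hct
    · exact hp3 c hc hct
  -- above the middle: hard Lefschetz
  intro p c hc hct
  by_cases hp : 2 * p ≤ A.dim
  · exact hlow p hp c hc hct
  · exact mem_algebraicClasses_of_lt_of_nonempty (nonempty_hardLefschetzNFold_holds A.dim A.X) hX
      (by omega) (hlow (A.dim - p) (by omega)) c hc hct

/-- **Assembly of route `SevenfoldWeilCensus`** (item stmt-HodgeConjecture-18724, the SEVENFOLD
REDUCTION): `CodimTwoFromLowerDim → CodimThreeWeilGeneration → WeilSixfolds → HodgeAbelianDimLeFive →`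
the Hodge conjecture `HodgeConjectureFor A.dim A.X` for every complex abelian variety `A` of
dimension `≤ 7`. Hodge models exist unconditionally (`nonempty_hodgeModel_holds`); the cycle part is
`sevenfoldWeilCensus_mem_algebraicClasses_of_dim_le_seven`. -/
theorem sevenfoldWeilCensus_assembly_proof :
    Summit.HodgeConjecture.HodgeConjecture.Theses.SevenfoldWeilCensus.Assembly := by
  intro h₃ h₂ h₄ h₅ A hA7 hX
  exact ⟨nonempty_hodgeModel_holds hX,
    sevenfoldWeilCensus_mem_algebraicClasses_of_dim_le_seven h₃ h₂ h₄ h₅ A.dim A rfl hA7⟩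

end Summit.HodgeConjecture.HodgeConjecture.Theorems

end
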